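/-
Copyright (c) 2026 the pub-hodgecm-mathlib formalisation cell (harness21).  Prover seat hodgecm-mathlib-K2E1-p13 (g3), Track B ∕ K2-LIT, h413 = `stmt-HodgeConjecture-24833`,
line `K2_E1_TraceFormulaBeta`, route of record `HCCMUnconditional`; dealer K2E1-plan (g7) (265)∕(266) AMENDMENT #3 C.3 ∕ G7 («hconj at a `c_G`-stable level `K′ = K_∞·K_f(𝔫)`,
`𝔫̄ = 𝔫`), census item (N2)(a): (H3) AT A GENERAL LEVEL — the double-coset edition of ★ `K2E1ChiSectionGaloisTwistU2.conj_apply_eq_apply_galTwist_of_selfDual` (this lineage, g2).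
-/
import Summits.HodgeConjecture.HodgeConjecture.Theorems.K2E1ChiSectionGaloisTwistU2      -- ★ p860352 (this lineage, g2): (S1)(S2)(S3) `apply_galTwist_borel_mul`, `apply_units_map_conjAdele_of_selfDual`, (H3) at `K_max`
import Summits.HodgeConjecture.HodgeConjecture.Theorems.K2E1ChiSectionSpaceU2Defs       -- ★ p859551 (K2-defs1): `chiSectionSpace χ K′ ω`, `apply_mul_of_mem`, `isChiSection_of_mem`, double-coset reps
import HarnessLib

/-!
# K2·E1 — `K2E1ChiSectionGaloisTwistLevelU2`: (H3) AT A GENERAL `c_G`-STABLE LEVEL — `conj ∘ φ = φ ∘ c_G` FOR A SECTION `φ ∈ V(χ, K′, ω)` OF A SELF-DUAL UNITARY `χ` FROM ITS REALNESS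
# ON A SET OF `(B(𝔸), K′)`-DOUBLE-COSET REPRESENTATIVES (the level-`𝔫` edition of ★ (H3); AMENDMENT #3 G7 groundwork)

Track B ∕ K2-LIT, crux h413 = `stmt-HodgeConjecture-24833`; cell `hodgecm-mathlib`, squad K2, ENGINE E1, AMENDMENT #3 «GENERAL (U,τ) LADDER» G7 (hconj ⇒ hadj at `𝔫̄ = 𝔫` levels).
THEOREMS ONLY (no `def`, no `instance`, no notation, no named-fact hypothesis, no `sorry`; default heartbeats); lane `--kind proof --supports stmt-HodgeConjecture-24833 --as helper`
(count-neutral).  Closes no socket.  Rank-generic `(F, E, c, N)`, hypothesis-first on `(cG, hcG)` and on the level data.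

THE MATHEMATICS ([MoeglinWaldspurger1995, I.2.17, II.1.7]; [GelbartRogawski1991, §3.1]; [Borel1997, §3.2]).  ★ (H3) `conj_apply_eq_apply_galTwist_of_selfDual` proves `conj (φ g) = φ (c_G g)`
for a right-`K`-invariant section with `φ(1) ∈ ℝ` when `G(𝔸) = B(𝔸)·K` is ONE double coset (`K = K_max`, the M1 datum).  At a deeper level `K′` (a `c_G`-stable open subgroup, e.g.
`K_∞·K_f(𝔫)` with `𝔫̄ = 𝔫` — the (K)-letter) with a `K′`-type `ω`, `G(𝔸) = ⨆_q B(𝔸)·s_q·K′` over finitely many representatives (★ `forall_exists_borel_mul_out_mul_of_iwasawa`), a section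
`φ ∈ V(χ, K′, ω)` is determined by its values `φ(s_q)` (★ `eval_injective`), and the SAME computation ((S2) twisted equivariance ★ `apply_galTwist_borel_mul`, (S3) `χ((c⊗1)a) = conj χ(a)` ★
`apply_units_map_conjAdele_of_selfDual`, the `ω`-rule ★ `apply_mul_of_mem`) gives: **if `conj (φ (s_q)) = φ (c_G s_q)` for every representative and `conj (ω k) = ω (c_G k)` on `K′`,
then `conj (φ g) = φ (c_G g)` for EVERY `g`** — the realness letter `hreal` of ★ `htube_of_godementScalar` ∕ of the matrix editions at level `K′` reduces to FINITELY MANY conditions on a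
basis (the existence of such `c_G`-real bases is the separate item (N2)(b)).
* §1 **`conj_apply_eq_apply_galTwist_of_selfDual_of_reps`** (general `ω`), **`conj_apply_eq_apply_galTwist_of_selfDual_of_reps_one`** (`ω = 1`: no `hω`).
HONEST LABEL: HC_CM is proved only modulo the 7 printed citations (2 remaining named inputs: hLiu418 = `stmt-HodgeConjecture-24832`, h413 = `stmt-HodgeConjecture-24833`) until rung 0
closes; this file asserts no named fact and closes no socket; count-neutral; hypothesis-first on `hIw`, `hK`, `hω`, `hreps`.

## References
* [MoeglinWaldspurger1995] C. Mœglin, J.-L. Waldspurger, *Spectral decomposition and Eisenstein series* (1995), I.2.17, II.1.7.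
* [GelbartRogawski1991] S. Gelbart, J. Rogawski, *L-functions and Fourier–Jacobi coefficients for the unitary group U(3)*, Invent. Math. 105 (1991), §3.1.
* [Borel1997] A. Borel, *Automorphic forms on SL₂(ℝ)* (1997), §3.2 (finiteness of double cosets, sections determined on representatives).
-/

set_option autoImplicit false
set_option linter.dupNamespace false  -- the mandated namespace repeats the summit's segment (`HodgeConjecture.HodgeConjecture`)

noncomputable section

open NumberField IsDedekindDomain
open scoped NNReal MatrixGroups ComplexConjugate
open Literature.NumberTheory.Automorphic Literature.NumberTheory.Automorphic.UnitaryGroup AdelicGroupData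
open Literature.NumberTheory.GaloisRepresentations (HeckeCharacter)
open Summit.HodgeConjecture.HodgeConjecture.Cruxes.H413.K2E1BorelEisensteinU
open Summit.HodgeConjecture.HodgeConjecture.Cruxes.H413.K2E1CharacterEisensteinU2Defs
open Summit.HodgeConjecture.HodgeConjecture.Cruxes.H413.K2E1ChiSectionSpaceU2Defs
open Summit.HodgeConjecture.HodgeConjecture.Cruxes.H413.K2E1QuasiSplitGaloisTwistU2
open Summit.HodgeConjecture.HodgeConjecture.Cruxes.H413.K2E1ChiSectionGaloisTwistU2 (apply_galTwist_borel_mul apply_units_map_conjAdele_of_selfDual)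

namespace Summit.HodgeConjecture.HodgeConjecture.Cruxes.H413.K2E1ChiSectionGaloisTwistLevelU2

variable {F E : Type} [Field F] [NumberField F] [Field E] [NumberField E] [Algebra F E] {c : E ≃ₐ[F] E} {N : ℕ} [NeZero N]

/-! ## §1 (H3) at a general `c_G`-stable level, from realness on double-coset representatives -/

/-- **(H3) AT LEVEL `(K′, ω)`: `conj (φ g) = φ (c_G g)` FOR EVERY `g`**, for a section `φ ∈ V(χ, K′, ω)` of a SELF-DUAL UNITARY `χ`, given: representatives `s_q` of the `(B(𝔸), K′)`-double
cosets (`hIw`), the `c_G`-stability of the level `c_G(K′) ⊆ K′` (`hK` — the (K)-letter, `𝔫̄ = 𝔫`), the compatibility `conj (ω k) = ω (c_G k)` of the `K′`-type (`hω`), and the REALNESS OF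
THE SECTION ON THE REPRESENTATIVES `conj (φ (s_q)) = φ (c_G s_q)` (`hreps`).  Both sides equal `conj χ(b₀₀)·ω(c_G k)·φ(c_G s_q)` at `g = b·s_q·k` ((S2), (S3), the `ω`-rule).
[cite: MoeglinWaldspurger1995, I.2.17, II.1.7] [cite: GelbartRogawski1991, §3.1] [cite: Borel1997, §3.2] -/
theorem conj_apply_eq_apply_galTwist_of_selfDual_of_reps (hc : c * c = 1) {cG : (quasiSplit F E c N).Adelic →* (quasiSplit F E c N).Adelic}
    (hcG : ∀ g, adelicVal F E c N _ (cG g) = Matrix.GeneralLinearGroup.map (conjAdele F E c) (adelicVal F E c N _ g))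
    (K' : Subgroup (quasiSplit F E c N).Adelic) (hK : ∀ k : ↥K', cG (k : (quasiSplit F E c N).Adelic) ∈ K')
    {ω : ↥K' → ℂ} (hω : ∀ k : ↥K', conj (ω k) = ω ⟨cG (k : (quasiSplit F E c N).Adelic), hK k⟩)
    {ι : Type*} (s : ι → (quasiSplit F E c N).Adelic)
    (hIw : ∀ g : (quasiSplit F E c N).Adelic, ∃ b ∈ borelAdelic F E c N, ∃ q : ι, ∃ k : ↥K', g = b * s q * (k : (quasiSplit F E c N).Adelic))
    {χ : HeckeCharacter E} (hsd : reflectChar c χ = χ) (hχ : χ.IsUnitary)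
    {φ : (quasiSplit F E c N).Adelic → ℂ} (hφV : φ ∈ chiSectionSpace χ K' ω)
    (hreps : ∀ q, conj (φ (s q)) = φ (cG (s q))) :
    ∀ g, conj (φ g) = φ (cG g) := by
  intro g
  obtain ⟨b, hb, q, k, rfl⟩ := hIw g
  have h1 : φ (cG (s q) * cG (k : (quasiSplit F E c N).Adelic)) = ω ⟨cG (k : (quasiSplit F E c N).Adelic), hK k⟩ * φ (cG (s q)) :=
    apply_mul_of_mem hφV (cG (s q)) ⟨cG (k : (quasiSplit F E c N).Adelic), hK k⟩
  rw [mul_assoc, (isChiSection_of_mem hφV) b hb, map_mul (starRingEnd ℂ), apply_mul_of_mem hφV (s q) k, map_mul (starRingEnd ℂ), hω k, hreps q,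
    apply_galTwist_borel_mul hc hcG (isChiSection_of_mem hφV) hb, apply_units_map_conjAdele_of_selfDual hsd hχ, map_mul cG (s q), h1]

/-- **(H3) AT LEVEL `K′` WITH TRIVIAL `K′`-TYPE (`ω = 1`)**: the same without `hω`. [cite: MoeglinWaldspurger1995, I.2.17, II.1.7] [cite: GelbartRogawski1991, §3.1] -/
theorem conj_apply_eq_apply_galTwist_of_selfDual_of_reps_one (hc : c * c = 1) {cG : (quasiSplit F E c N).Adelic →* (quasiSplit F E c N).Adelic}
    (hcG : ∀ g, adelicVal F E c N _ (cG g) = Matrix.GeneralLinearGroup.map (conjAdele F E c) (adelicVal F E c N _ g))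
    (K' : Subgroup (quasiSplit F E c N).Adelic) (hK : ∀ k : ↥K', cG (k : (quasiSplit F E c N).Adelic) ∈ K')
    {ι : Type*} (s : ι → (quasiSplit F E c N).Adelic)
    (hIw : ∀ g : (quasiSplit F E c N).Adelic, ∃ b ∈ borelAdelic F E c N, ∃ q : ι, ∃ k : ↥K', g = b * s q * (k : (quasiSplit F E c N).Adelic))
    {χ : HeckeCharacter E} (hsd : reflectChar c χ = χ) (hχ : χ.IsUnitary)
    {φ : (quasiSplit F E c N).Adelic → ℂ} (hφV : φ ∈ chiSectionSpace χ K' (fun _ => 1))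
    (hreps : ∀ q, conj (φ (s q)) = φ (cG (s q))) :
    ∀ g, conj (φ g) = φ (cG g) :=
  conj_apply_eq_apply_galTwist_of_selfDual_of_reps hc hcG K' hK (ω := fun _ => 1) (fun _ => by rw [map_one]) s hIw hsd hχ hφV hreps

end Summit.HodgeConjecture.HodgeConjecture.Cruxes.H413.K2E1ChiSectionGaloisTwistLevelU2

end
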